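import Mathlib.Tactic
import HarnessLib

/-!
# Kozma–Nitzan's Question 8 at three relays — LEMMA K⁺: the c-sensitive lower bound for κ̂ (gen 27)

Support file (`--supports stmt-CriticalPhenomena-4575`, closed crux; independent mathematics on Kozma–Nitzan's Question 8,
arXiv:2401.12397 §5.5 p. 36), prover `prim-ineq-gen-6` (gen 27).  No definitions, no named facts, no sorries; standard axioms.
Memo `run/shared/lean/prim/prim-ineq-gen-6/FINDING-G27.md` §2(k).

THEOREM K (gen 24, `theta_kappa_nonneg`) says `κ̂_j ≥ 0` when the out-defect `c ≤ 0`.  For `c > 0` the same decomposition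
`κ̂_j = a u″L_j + γ v″W_j`, `W_j = (Φ+m−c)(1−a) + a(Φ+m)(1−Φ) − a²Φ·G` (`G = S_{j+1}u″ ≤ 1 − ε`, hypothesis-free), gives the SHARP
c-sensitive bound (census max ratio 1, attained at `a = 1`):
`W_j ≥ Φ(1+π)(1−a)(1+a−aΦ) − (πΦ−m)·[Φa² + 1 − aΦ + (1−a)D/Φ]`, hence
`κ̂_j ≥ −γ_j v″ (πΦ − m)·[1 − a_jΦ(1−a_j) + (1−a_j)D/Φ]` (`W_lower_csensitive`, `kappahat_lower_csensitive`):
every positive subtree sum of the chain SSC(U) → (UNI) is `O(πΦ − m) = O(cΦ/D)`.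
[cite: KozmaNitzan2024, Question 8 (§5.5 p. 36)]
-/

namespace Summit.CriticalPhenomena.PercolationContinuityZ3.Theorems

namespace PocketCert

/-- **LEMMA K⁺ (the far coefficient).**  With the block moments `0 ≤ m ≤ π`, `0 < Φ ≤ 1`, `D = Φ − π`, `ε = D + m`, out-defect
`c = D(πΦ − m)/Φ`, a prefix mark `0 ≤ a ≤ 1` and the far quantity `G ≤ 1 − ε` (T4 of THEOREM K), the coefficient
`W = (Φ+m−c)(1−a) + a(Φ+m)(1−Φ) − a²ΦG` satisfies `W ≥ −(πΦ−m)·(Φa² + 1 − aΦ + (1−a)D/Φ)`.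
[cite: KozmaNitzan2024, Question 8 (§5.5 p. 36)] -/
theorem W_lower_csensitive (Φ π m a G : ℝ) (hΦ : 0 < Φ) (hΦ1 : Φ ≤ 1) (hm : 0 ≤ m) (hmπ : m ≤ π)
    (ha0 : 0 ≤ a) (ha1 : a ≤ 1) (hG : G ≤ 1 - ((Φ - π) + m)) :
    -((π * Φ - m) * (Φ * a ^ 2 + 1 - a * Φ + (1 - a) * (Φ - π) / Φ))
      ≤ (Φ + m - (Φ - π) * (π * Φ - m) / Φ) * (1 - a) + a * (Φ + m) * (1 - Φ) - a ^ 2 * Φ * G := by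
  -- clear the denominator Φ and reduce to the polynomial core
  have hπ : 0 ≤ π := le_trans hm hmπ
  have key : Φ * ((Φ + m - (Φ - π) * (π * Φ - m) / Φ) * (1 - a) + a * (Φ + m) * (1 - Φ) - a ^ 2 * Φ * G)
      + Φ * ((π * Φ - m) * (Φ * a ^ 2 + 1 - a * Φ + (1 - a) * (Φ - π) / Φ))
      ≥ Φ ^ 2 * (1 + π) * (1 - a) * (1 + a - a * Φ) := by
    have e1 : Φ * ((Φ + m - (Φ - π) * (π * Φ - m) / Φ) * (1 - a) + a * (Φ + m) * (1 - Φ) - a ^ 2 * Φ * G)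
        = (Φ * (Φ + m) - (Φ - π) * (π * Φ - m)) * (1 - a) + Φ * a * (Φ + m) * (1 - Φ) - Φ * a ^ 2 * Φ * G := by
      field_simp
    have e2 : Φ * ((π * Φ - m) * (Φ * a ^ 2 + 1 - a * Φ + (1 - a) * (Φ - π) / Φ))
        = (π * Φ - m) * (Φ * (Φ * a ^ 2 + 1 - a * Φ) + (1 - a) * (Φ - π)) := by
      field_simp
    rw [e1, e2]
    -- use G ≤ 1 − ε with the nonnegative coefficient Φ² a²
    have hGa : Φ * a ^ 2 * Φ * G ≤ Φ * a ^ 2 * Φ * (1 - ((Φ - π) + m)) :=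
      mul_le_mul_of_nonneg_left hG (by positivity)
    nlinarith [mul_nonneg hm ha0, mul_nonneg hπ ha0, mul_nonneg (sub_nonneg.2 ha1) hπ, mul_nonneg (sub_nonneg.2 hΦ1) ha0,
      mul_nonneg (mul_nonneg ha0 ha0) hm,
      mul_nonneg (mul_nonneg ha0 (sub_nonneg.2 ha1)) hΦ.le, mul_nonneg (mul_nonneg hπ hm) ha0,
      mul_nonneg (mul_nonneg hm (sub_nonneg.2 hΦ1)) ha0, mul_nonneg (mul_nonneg hπ (sub_nonneg.2 hΦ1)) (sub_nonneg.2 ha1)]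
  have pos : 0 ≤ Φ ^ 2 * (1 + π) * (1 - a) * (1 + a - a * Φ) := by
    have h1 : 0 ≤ 1 + a - a * Φ := by nlinarith
    have := mul_nonneg (mul_nonneg (mul_nonneg (sq_nonneg Φ) (by linarith : (0:ℝ) ≤ 1 + π)) (sub_nonneg.2 ha1)) h1
    simpa using this
  -- divide by Φ > 0
  by_contra h
  have h' := not_le.mp h
  have : Φ * ((Φ + m - (Φ - π) * (π * Φ - m) / Φ) * (1 - a) + a * (Φ + m) * (1 - Φ) - a ^ 2 * Φ * G)
      + Φ * ((π * Φ - m) * (Φ * a ^ 2 + 1 - a * Φ + (1 - a) * (Φ - π) / Φ)) < 0 := by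
    have := mul_lt_mul_of_pos_left h' hΦ
    nlinarith
  linarith

/-- **LEMMA K⁺ (the depth quantity).**  In the symmetric form `κ̂ = a u L + γ v W` with `a, u, L, γ, v ≥ 0` and the coefficient bound of
`W_lower_csensitive`, `κ̂ ≥ −γ v (πΦ−m)(Φa² + 1 − aΦ + (1−a)D/Φ)`: the positive subtree sums `U = s(−κ̂ + …)` are `O(πΦ − m)`.
[cite: KozmaNitzan2024, Question 8 (§5.5 p. 36)] -/
theorem kappahat_lower_csensitive (κ a u L γ v W P B : ℝ) (hκ : κ = a * u * L + γ * v * W) (ha : 0 ≤ a) (hu : 0 ≤ u)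
    (hL : 0 ≤ L) (hγ : 0 ≤ γ) (hv : 0 ≤ v) (hW : -(P * B) ≤ W) : -(γ * v * (P * B)) ≤ κ := by
  have h1 : 0 ≤ a * u * L := mul_nonneg (mul_nonneg ha hu) hL
  have h2 : γ * v * (-(P * B)) ≤ γ * v * W := mul_le_mul_of_nonneg_left hW (mul_nonneg hγ hv)
  rw [hκ]
  linarith

end PocketCert

end Summit.CriticalPhenomena.PercolationContinuityZ3.Theorems
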